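import Summits.CriticalPhenomena.PercolationContinuityZ3.Theorems.PercNearOneGluingNoHeavyLowerTailKnQuestion8CoefficientwiseOffCluster
import HarnessLib

/-!
# The two-point exclusion `Q_mix(p,q)` and NO-CORE(y) in the dominated / dominating positions (prim-lf-2 gen 47)

Support file (`--supports stmt-CriticalPhenomena-4575`, closed), prover `prim-lf-2` (gen 47).  No definitions, no named facts, no sorries;
standard axioms.  Memo `prim-lf-2/CW-QMIX-gen47.md` §2; CONJECTURE NO-CORE / Q_mix: `prim-lf-2/CW-BOX-gen46.md` §0(i), §2(d),(f).

Setting.  Finite multigraph `ends : ι → Sym2 V`, root `x`; a colouring is `s : Finset ι` (RED edges), `sᶜ` the BLUE edges;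
`K(s) = C_x(s) = openCluster (ends '' s) x` is the red cluster of `x`, `K(sᶜ)` the blue one; `f, g : Set V → ℝ` monotone, `Δf(s) = f(K s) − f(K sᶜ)`.
The two-point exclusion of the BOX programme is
  `Q_mix(p,q) := Σ_{s : ¬(p ∈ K s ∧ q ∈ K sᶜ)} Δf(s)·Δg(s)`     (`p` red-reached and `q` blue-reached not both),
with `Q_mix(y,y) = NO-CORE(y) = Σ_{y ∉ K s ∩ K sᶜ} ΔfΔg` ('`y` is not doubly reached'); CONJECTURE Q_mix ≥ 0 (0 negatives on all graphs with ≤ 7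
vertices; NO-CORE through 8 vertices / 12 edges) is the wall-free face of CONJECTURE BOX and gives NO-CORE at every degree-two vertex
(`NO-CORE(y) = H(G − y + pq) + 2·Q_mix^{G−y}(p,q)`, `N(y) = {p,q}`).  This file proves the POSITIONAL cases in which the excluded summands are signed:

* `Coefficientwise.excluded_summand_nonpos` — if `f` or `g` is SATURATED whenever `p` is red-reached (`p ∈ K s → f(K s) = Mf ∨ g(K s) = Mg`, `Mf, Mg`
  upper bounds) and likewise for `q`, then every excluded summand `[p ∈ K s][q ∈ K sᶜ]·Δf(s)Δg(s)` is `≤ 0`;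
* `Coefficientwise.qmix_ge_harris_of_dominated`, `Coefficientwise.qmix_nonneg_of_dominated` — hence `Q_mix(p,q) ≥ H := Σ_s ΔfΔg ≥ 0`
  (`harris_twoColouring`).  For the point functions `f = [u ∈ ·]`, `g = [w ∈ ·]` the hypothesis reads '`p ∈ C_x ⇒ u ∈ C_x ∨ w ∈ C_x`' (every red
  path from `x` to `p` passes a point, e.g. `{u,w}` separates `p` from `x`), and it is EMPTY for `(p,q) = (u,w)`: `Coefficientwise.qmix_points_nonneg`
  — the two-point exclusion at the points themselves is a theorem on every multigraph;
* `Coefficientwise.noCore_ge_harris_of_dominated` / `noCore_nonneg_of_dominated` — the case `p = q = y`: if `y ∈ C_x ⇒ (f` or `g` saturated`)` then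
  `BOTH(y) = Σ_{y ∈ K ∩ K̄} ΔfΔg ≤ 0` and `NO-CORE(y) ≥ H ≥ 0` ('`y` behind the points');
* `Coefficientwise.noCore_summand_nonneg_of_dominating`, `noCore_nonneg_of_dominating` — the opposite position: if `f` and `g` are MINIMAL whenever
  `y` is not red-reached (`y ∉ K s → f(K s) = mf ∧ g(K s) = mg`; for points: '`u ∈ C_x ∨ w ∈ C_x ⇒ y ∈ C_x`', `y` separates `x` from the points), every
  NO-CORE summand is `≥ 0`.
Together with gen 46's `noCore_twoColouring_nonneg_of_adj` (`y ∼ x`) these are the settled positional cases of CONJECTURE NO-CORE; the first open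
position is dist(x,y) = 2 with `y` beside the points.
[cite: KozmaNitzan2024, Questions 8–9 (§5.5 p. 36) (context: the Question-8 pocket covariance programme)]
-/

namespace Summit.CriticalPhenomena.PercolationContinuityZ3.Theorems

open Finset Literature.Probability.Percolation

namespace Coefficientwise

variable {ι V : Type*} [Fintype ι] [DecidableEq ι] (ends : ι → Sym2 V) (x : V)

/-- Sign lemma behind the dominated position: if `a ≤ Mf`, `b ≤ Mg` componentwise bounds hold and (`a₁ = Mf ∨ b₁ = Mg`) and (`a₂ = Mf ∨ b₂ = Mg`),
then `(a₁ − a₂)(b₁ − b₂) ≤ 0`. [cite: KozmaNitzan2024, §5.5 (context only; elementary)] -/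
theorem mul_sub_nonpos_of_saturated {a₁ a₂ b₁ b₂ Mf Mg : ℝ} (ha₁ : a₁ ≤ Mf) (ha₂ : a₂ ≤ Mf) (hb₁ : b₁ ≤ Mg) (hb₂ : b₂ ≤ Mg)
    (h₁ : a₁ = Mf ∨ b₁ = Mg) (h₂ : a₂ = Mf ∨ b₂ = Mg) : (a₁ - a₂) * (b₁ - b₂) ≤ 0 := by
  rcases h₁ with h₁ | h₁ <;> rcases h₂ with h₂ | h₂
  · have : a₁ - a₂ = 0 := by rw [h₁, h₂]; ring
    rw [this, zero_mul]
  · exact mul_nonpos_of_nonneg_of_nonpos (by rw [h₁]; linarith) (by rw [h₂]; linarith)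
  · exact mul_nonpos_of_nonpos_of_nonneg (by rw [h₂]; linarith) (by rw [h₁]; linarith)
  · have : b₁ - b₂ = 0 := by rw [h₁, h₂]; ring
    rw [this, mul_zero]

/-- **The excluded summands of `Q_mix(p,q)` are non-positive in the dominated position.**  If `f ≤ Mf`, `g ≤ Mg` on red clusters, `f` or `g` is
saturated whenever `p` is red-reached, and `f` or `g` is saturated whenever `q` is red-reached, then for every colouring `s` with `p ∈ K s` and
`q ∈ K sᶜ`: `(f(K s) − f(K sᶜ))(g(K s) − g(K sᶜ)) ≤ 0`. [cite: KozmaNitzan2024, Questions 8–9 (§5.5 p. 36) (context)] -/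
theorem excluded_summand_nonpos (p q : V) (f g : Set V → ℝ) {Mf Mg : ℝ}
    (hfM : ∀ s : Finset ι, f (openCluster (ends '' (↑(s : Finset ι) : Set ι)) x) ≤ Mf) (hgM : ∀ s : Finset ι, g (openCluster (ends '' (↑(s : Finset ι) : Set ι)) x) ≤ Mg)
    (hp : ∀ s : Finset ι, p ∈ openCluster (ends '' (↑(s : Finset ι) : Set ι)) x → f (openCluster (ends '' (↑(s : Finset ι) : Set ι)) x) = Mf ∨ g (openCluster (ends '' (↑(s : Finset ι) : Set ι)) x) = Mg)
    (hq : ∀ s : Finset ι, q ∈ openCluster (ends '' (↑(s : Finset ι) : Set ι)) x → f (openCluster (ends '' (↑(s : Finset ι) : Set ι)) x) = Mf ∨ g (openCluster (ends '' (↑(s : Finset ι) : Set ι)) x) = Mg)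
    (s : Finset ι) (hps : p ∈ openCluster (ends '' (↑(s : Finset ι) : Set ι)) x) (hqs : q ∈ openCluster (ends '' (↑(sᶜ : Finset ι) : Set ι)) x) :
    (f (openCluster (ends '' (↑(s : Finset ι) : Set ι)) x) - f (openCluster (ends '' (↑(sᶜ : Finset ι) : Set ι)) x)) * (g (openCluster (ends '' (↑(s : Finset ι) : Set ι)) x) - g (openCluster (ends '' (↑(sᶜ : Finset ι) : Set ι)) x)) ≤ 0 :=
  mul_sub_nonpos_of_saturated (hfM s) (hfM sᶜ) (hgM s) (hgM sᶜ) (hp s hps) (hq sᶜ hqs)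

open Classical in
/-- **`Q_mix(p,q) ≥ H` in the dominated position.**  Under the hypotheses of `excluded_summand_nonpos`,
`Σ_s ΔfΔg ≤ Σ_{s : ¬(p ∈ K s ∧ q ∈ K sᶜ)} ΔfΔg`. [cite: KozmaNitzan2024, Questions 8–9 (§5.5 p. 36) (context)] -/
theorem qmix_ge_harris_of_dominated (p q : V) (f g : Set V → ℝ) {Mf Mg : ℝ}
    (hfM : ∀ s : Finset ι, f (openCluster (ends '' (↑(s : Finset ι) : Set ι)) x) ≤ Mf) (hgM : ∀ s : Finset ι, g (openCluster (ends '' (↑(s : Finset ι) : Set ι)) x) ≤ Mg)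
    (hp : ∀ s : Finset ι, p ∈ openCluster (ends '' (↑(s : Finset ι) : Set ι)) x → f (openCluster (ends '' (↑(s : Finset ι) : Set ι)) x) = Mf ∨ g (openCluster (ends '' (↑(s : Finset ι) : Set ι)) x) = Mg)
    (hq : ∀ s : Finset ι, q ∈ openCluster (ends '' (↑(s : Finset ι) : Set ι)) x → f (openCluster (ends '' (↑(s : Finset ι) : Set ι)) x) = Mf ∨ g (openCluster (ends '' (↑(s : Finset ι) : Set ι)) x) = Mg) :
    ∑ s : Finset ι, (f (openCluster (ends '' (↑(s : Finset ι) : Set ι)) x) - f (openCluster (ends '' (↑(sᶜ : Finset ι) : Set ι)) x)) * (g (openCluster (ends '' (↑(s : Finset ι) : Set ι)) x) - g (openCluster (ends '' (↑(sᶜ : Finset ι) : Set ι)) x)) ≤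
    ∑ s ∈ univ.filter (fun s : Finset ι => ¬ (p ∈ openCluster (ends '' (↑(s : Finset ι) : Set ι)) x ∧ q ∈ openCluster (ends '' (↑(sᶜ : Finset ι) : Set ι)) x)),
      (f (openCluster (ends '' (↑(s : Finset ι) : Set ι)) x) - f (openCluster (ends '' (↑(sᶜ : Finset ι) : Set ι)) x)) * (g (openCluster (ends '' (↑(s : Finset ι) : Set ι)) x) - g (openCluster (ends '' (↑(sᶜ : Finset ι) : Set ι)) x)) := by
  set Φ : Finset ι → ℝ := fun s => (f (openCluster (ends '' (↑(s : Finset ι) : Set ι)) x) - f (openCluster (ends '' (↑(sᶜ : Finset ι) : Set ι)) x)) * (g (openCluster (ends '' (↑(s : Finset ι) : Set ι)) x) - g (openCluster (ends '' (↑(sᶜ : Finset ι) : Set ι)) x)) with hΦ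
  have hsplit := Finset.sum_filter_add_sum_filter_not (univ : Finset (Finset ι)) (fun s : Finset ι => ¬ (p ∈ openCluster (ends '' (↑(s : Finset ι) : Set ι)) x ∧ q ∈ openCluster (ends '' (↑(sᶜ : Finset ι) : Set ι)) x)) Φ
  have hneg : ∑ s ∈ univ.filter (fun s : Finset ι => ¬ ¬ (p ∈ openCluster (ends '' (↑(s : Finset ι) : Set ι)) x ∧ q ∈ openCluster (ends '' (↑(sᶜ : Finset ι) : Set ι)) x)), Φ s ≤ 0 := by
    refine Finset.sum_nonpos fun s hs => ?_
    have h : p ∈ openCluster (ends '' (↑(s : Finset ι) : Set ι)) x ∧ q ∈ openCluster (ends '' (↑(sᶜ : Finset ι) : Set ι)) x := not_not.mp (Finset.mem_filter.mp hs).2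
    exact excluded_summand_nonpos ends x p q f g hfM hgM hp hq s h.1 h.2
  change ∑ s : Finset ι, Φ s ≤ ∑ s ∈ univ.filter (fun s : Finset ι => ¬ (p ∈ openCluster (ends '' (↑(s : Finset ι) : Set ι)) x ∧ q ∈ openCluster (ends '' (↑(sᶜ : Finset ι) : Set ι)) x)), Φ s
  linarith

open Classical in
/-- **`Q_mix(p,q) ≥ 0` in the dominated position** (Harris' two-colouring inequality for the full sum). [cite: KozmaNitzan2024, Questions 8–9 (§5.5 p. 36) (context)] -/
theorem qmix_nonneg_of_dominated (p q : V) (f g : Set V → ℝ) (hf : Monotone f) (hg : Monotone g) {Mf Mg : ℝ}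
    (hfM : ∀ s : Finset ι, f (openCluster (ends '' (↑(s : Finset ι) : Set ι)) x) ≤ Mf) (hgM : ∀ s : Finset ι, g (openCluster (ends '' (↑(s : Finset ι) : Set ι)) x) ≤ Mg)
    (hp : ∀ s : Finset ι, p ∈ openCluster (ends '' (↑(s : Finset ι) : Set ι)) x → f (openCluster (ends '' (↑(s : Finset ι) : Set ι)) x) = Mf ∨ g (openCluster (ends '' (↑(s : Finset ι) : Set ι)) x) = Mg)
    (hq : ∀ s : Finset ι, q ∈ openCluster (ends '' (↑(s : Finset ι) : Set ι)) x → f (openCluster (ends '' (↑(s : Finset ι) : Set ι)) x) = Mf ∨ g (openCluster (ends '' (↑(s : Finset ι) : Set ι)) x) = Mg) :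
    0 ≤ ∑ s ∈ univ.filter (fun s : Finset ι => ¬ (p ∈ openCluster (ends '' (↑(s : Finset ι) : Set ι)) x ∧ q ∈ openCluster (ends '' (↑(sᶜ : Finset ι) : Set ι)) x)),
      (f (openCluster (ends '' (↑(s : Finset ι) : Set ι)) x) - f (openCluster (ends '' (↑(sᶜ : Finset ι) : Set ι)) x)) * (g (openCluster (ends '' (↑(s : Finset ι) : Set ι)) x) - g (openCluster (ends '' (↑(sᶜ : Finset ι) : Set ι)) x)) := by
  have hH : 0 ≤ ∑ s : Finset ι, (f (openCluster (ends '' (↑(s : Finset ι) : Set ι)) x) - f (openCluster (ends '' (↑(sᶜ : Finset ι) : Set ι)) x)) * (g (openCluster (ends '' (↑(s : Finset ι) : Set ι)) x) - g (openCluster (ends '' (↑(sᶜ : Finset ι) : Set ι)) x)) :=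
    harris_twoColouring (fun s : Finset ι => f (openCluster (ends '' (↑(s : Finset ι) : Set ι)) x)) (fun s : Finset ι => g (openCluster (ends '' (↑(s : Finset ι) : Set ι)) x))
      (fun s t hst => hf (openCluster_image_mono ends hst x)) (fun s t hst => hg (openCluster_image_mono ends hst x))
  exact hH.trans (qmix_ge_harris_of_dominated ends x p q f g hfM hgM hp hq)

open Classical in
/-- **NO-CORE(y) ≥ H when `y` is dominated** (`p = q = y`): if `f` or `g` is saturated whenever `y` is red-reached, then
`BOTH(y) = Σ_{y ∈ K s ∩ K sᶜ} ΔfΔg ≤ 0`, i.e. `Σ_s ΔfΔg ≤ Σ_{s : ¬(y ∈ K s ∧ y ∈ K sᶜ)} ΔfΔg` — the left side of gen 46's `noCore_sum_eq`.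
[cite: KozmaNitzan2024, Questions 8–9 (§5.5 p. 36) (context)] -/
theorem noCore_ge_harris_of_dominated (y : V) (f g : Set V → ℝ) {Mf Mg : ℝ}
    (hfM : ∀ s : Finset ι, f (openCluster (ends '' (↑(s : Finset ι) : Set ι)) x) ≤ Mf) (hgM : ∀ s : Finset ι, g (openCluster (ends '' (↑(s : Finset ι) : Set ι)) x) ≤ Mg)
    (hy : ∀ s : Finset ι, y ∈ openCluster (ends '' (↑(s : Finset ι) : Set ι)) x → f (openCluster (ends '' (↑(s : Finset ι) : Set ι)) x) = Mf ∨ g (openCluster (ends '' (↑(s : Finset ι) : Set ι)) x) = Mg) :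
    ∑ s : Finset ι, (f (openCluster (ends '' (↑(s : Finset ι) : Set ι)) x) - f (openCluster (ends '' (↑(sᶜ : Finset ι) : Set ι)) x)) * (g (openCluster (ends '' (↑(s : Finset ι) : Set ι)) x) - g (openCluster (ends '' (↑(sᶜ : Finset ι) : Set ι)) x)) ≤
    ∑ s ∈ univ.filter (fun s : Finset ι => ¬ (y ∈ openCluster (ends '' (↑(s : Finset ι) : Set ι)) x ∧ y ∈ openCluster (ends '' (↑(sᶜ : Finset ι) : Set ι)) x)),
      (f (openCluster (ends '' (↑(s : Finset ι) : Set ι)) x) - f (openCluster (ends '' (↑(sᶜ : Finset ι) : Set ι)) x)) * (g (openCluster (ends '' (↑(s : Finset ι) : Set ι)) x) - g (openCluster (ends '' (↑(sᶜ : Finset ι) : Set ι)) x)) :=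
  qmix_ge_harris_of_dominated ends x y y f g hfM hgM hy hy

open Classical in
/-- **NO-CORE(y) ≥ 0 when `y` is dominated** ('`y` behind the points': for `f = [u ∈ ·]`, `g = [w ∈ ·]` the hypothesis is `y ∈ C_x(s) → u ∈ C_x(s) ∨ w ∈ C_x(s)`,
e.g. `{u,w}` separates `y` from `x`). [cite: KozmaNitzan2024, Questions 8–9 (§5.5 p. 36) (context)] -/
theorem noCore_nonneg_of_dominated (y : V) (f g : Set V → ℝ) (hf : Monotone f) (hg : Monotone g) {Mf Mg : ℝ}
    (hfM : ∀ s : Finset ι, f (openCluster (ends '' (↑(s : Finset ι) : Set ι)) x) ≤ Mf) (hgM : ∀ s : Finset ι, g (openCluster (ends '' (↑(s : Finset ι) : Set ι)) x) ≤ Mg)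
    (hy : ∀ s : Finset ι, y ∈ openCluster (ends '' (↑(s : Finset ι) : Set ι)) x → f (openCluster (ends '' (↑(s : Finset ι) : Set ι)) x) = Mf ∨ g (openCluster (ends '' (↑(s : Finset ι) : Set ι)) x) = Mg) :
    0 ≤ ∑ s ∈ univ.filter (fun s : Finset ι => ¬ (y ∈ openCluster (ends '' (↑(s : Finset ι) : Set ι)) x ∧ y ∈ openCluster (ends '' (↑(sᶜ : Finset ι) : Set ι)) x)),
      (f (openCluster (ends '' (↑(s : Finset ι) : Set ι)) x) - f (openCluster (ends '' (↑(sᶜ : Finset ι) : Set ι)) x)) * (g (openCluster (ends '' (↑(s : Finset ι) : Set ι)) x) - g (openCluster (ends '' (↑(sᶜ : Finset ι) : Set ι)) x)) :=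
  qmix_nonneg_of_dominated ends x y y f g hf hg hfM hgM hy hy

open Classical in
/-- **The two-point exclusion at the points is a theorem:** for any vertices `x, u, w` of any finite multigraph,
`0 ≤ Σ_{s : ¬(u ∈ K s ∧ w ∈ K sᶜ)} ([u ∈ K s] − [u ∈ K sᶜ])([w ∈ K s] − [w ∈ K sᶜ])` — `Q_mix(u,w) ≥ H ≥ 0` for the point functions, because on the
excluded colourings `σ_u ∈ {0,1}` and `σ_w ∈ {0,−1}`.  (Hence NO-CORE(y) for a degree-two `y` with `N(y) = {u,w}`, by the degree-two identity of memo
CW-BOX-gen46 §2(d).) [cite: KozmaNitzan2024, Questions 8–9 (§5.5 p. 36) (context)] -/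
theorem qmix_points_nonneg (u w : V) :
    0 ≤ ∑ s ∈ univ.filter (fun s : Finset ι => ¬ (u ∈ openCluster (ends '' (↑(s : Finset ι) : Set ι)) x ∧ w ∈ openCluster (ends '' (↑(sᶜ : Finset ι) : Set ι)) x)),
      ((if u ∈ openCluster (ends '' (↑(s : Finset ι) : Set ι)) x then (1 : ℝ) else 0) - (if u ∈ openCluster (ends '' (↑(sᶜ : Finset ι) : Set ι)) x then (1 : ℝ) else 0)) *
        ((if w ∈ openCluster (ends '' (↑(s : Finset ι) : Set ι)) x then (1 : ℝ) else 0) - (if w ∈ openCluster (ends '' (↑(sᶜ : Finset ι) : Set ι)) x then (1 : ℝ) else 0)) := by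
  set f : Set V → ℝ := fun C => if u ∈ C then (1 : ℝ) else 0 with hf
  set g : Set V → ℝ := fun C => if w ∈ C then (1 : ℝ) else 0 with hg
  have hfm : Monotone f := fun A B hAB => by
    simp only [hf]; by_cases hA : u ∈ A
    · simp [hA, hAB hA]
    · simp only [hA, if_false]; split_ifs <;> norm_num
  have hgm : Monotone g := fun A B hAB => by
    simp only [hg]; by_cases hA : w ∈ A
    · simp [hA, hAB hA]
    · simp only [hA, if_false]; split_ifs <;> norm_num
  have hfM : ∀ s : Finset ι, f (openCluster (ends '' (↑(s : Finset ι) : Set ι)) x) ≤ 1 := fun s => by simp only [hf]; split_ifs <;> norm_num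
  have hgM : ∀ s : Finset ι, g (openCluster (ends '' (↑(s : Finset ι) : Set ι)) x) ≤ 1 := fun s => by simp only [hg]; split_ifs <;> norm_num
  have hp : ∀ s : Finset ι, u ∈ openCluster (ends '' (↑(s : Finset ι) : Set ι)) x → f (openCluster (ends '' (↑(s : Finset ι) : Set ι)) x) = 1 ∨ g (openCluster (ends '' (↑(s : Finset ι) : Set ι)) x) = 1 := fun s hs => Or.inl (by simp only [hf, hs, if_true])
  have hq : ∀ s : Finset ι, w ∈ openCluster (ends '' (↑(s : Finset ι) : Set ι)) x → f (openCluster (ends '' (↑(s : Finset ι) : Set ι)) x) = 1 ∨ g (openCluster (ends '' (↑(s : Finset ι) : Set ι)) x) = 1 := fun s hs => Or.inr (by simp only [hg, hs, if_true])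
  exact qmix_nonneg_of_dominated ends x u w f g hfm hgm hfM hgM hp hq

/-- **The NO-CORE summands are nonnegative in the dominating position.**  If `mf ≤ f`, `mg ≤ g` on red clusters and both `f` and `g` are MINIMAL
whenever `y` is not red-reached (`y ∉ K s → f(K s) = mf ∧ g(K s) = mg`; for points: `y` separates `x` from `u` and from `w`), then for every colouring
with `y ∉ K s ∩ K sᶜ`: `0 ≤ (f(K s) − f(K sᶜ))(g(K s) − g(K sᶜ))`. [cite: KozmaNitzan2024, Questions 8–9 (§5.5 p. 36) (context)] -/
theorem noCore_summand_nonneg_of_dominating (y : V) (f g : Set V → ℝ) {mf mg : ℝ}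
    (hfm : ∀ s : Finset ι, mf ≤ f (openCluster (ends '' (↑(s : Finset ι) : Set ι)) x)) (hgm : ∀ s : Finset ι, mg ≤ g (openCluster (ends '' (↑(s : Finset ι) : Set ι)) x))
    (hy : ∀ s : Finset ι, y ∉ openCluster (ends '' (↑(s : Finset ι) : Set ι)) x → f (openCluster (ends '' (↑(s : Finset ι) : Set ι)) x) = mf ∧ g (openCluster (ends '' (↑(s : Finset ι) : Set ι)) x) = mg)
    (s : Finset ι) (hs : ¬ (y ∈ openCluster (ends '' (↑(s : Finset ι) : Set ι)) x ∧ y ∈ openCluster (ends '' (↑(sᶜ : Finset ι) : Set ι)) x)) :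
    0 ≤ (f (openCluster (ends '' (↑(s : Finset ι) : Set ι)) x) - f (openCluster (ends '' (↑(sᶜ : Finset ι) : Set ι)) x)) * (g (openCluster (ends '' (↑(s : Finset ι) : Set ι)) x) - g (openCluster (ends '' (↑(sᶜ : Finset ι) : Set ι)) x)) := by
  rcases not_and_or.mp hs with h | h
  · obtain ⟨h1, h2⟩ := hy s h
    exact mul_nonneg_of_nonpos_of_nonpos (by rw [h1]; linarith [hfm sᶜ]) (by rw [h2]; linarith [hgm sᶜ])
  · obtain ⟨h1, h2⟩ := hy sᶜ h
    exact mul_nonneg (by rw [h1]; linarith [hfm s]) (by rw [h2]; linarith [hgm s])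

open Classical in
/-- **NO-CORE(y) ≥ 0 in the dominating position** (and every sub-sum of it, e.g. the wall sum `WALL(y)`, is `≥ 0` too, all summands being `≥ 0`).
[cite: KozmaNitzan2024, Questions 8–9 (§5.5 p. 36) (context)] -/
theorem noCore_nonneg_of_dominating (y : V) (f g : Set V → ℝ) {mf mg : ℝ}
    (hfm : ∀ s : Finset ι, mf ≤ f (openCluster (ends '' (↑(s : Finset ι) : Set ι)) x)) (hgm : ∀ s : Finset ι, mg ≤ g (openCluster (ends '' (↑(s : Finset ι) : Set ι)) x))
    (hy : ∀ s : Finset ι, y ∉ openCluster (ends '' (↑(s : Finset ι) : Set ι)) x → f (openCluster (ends '' (↑(s : Finset ι) : Set ι)) x) = mf ∧ g (openCluster (ends '' (↑(s : Finset ι) : Set ι)) x) = mg) :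
    0 ≤ ∑ s ∈ univ.filter (fun s : Finset ι => ¬ (y ∈ openCluster (ends '' (↑(s : Finset ι) : Set ι)) x ∧ y ∈ openCluster (ends '' (↑(sᶜ : Finset ι) : Set ι)) x)),
      (f (openCluster (ends '' (↑(s : Finset ι) : Set ι)) x) - f (openCluster (ends '' (↑(sᶜ : Finset ι) : Set ι)) x)) * (g (openCluster (ends '' (↑(s : Finset ι) : Set ι)) x) - g (openCluster (ends '' (↑(sᶜ : Finset ι) : Set ι)) x)) :=
  Finset.sum_nonneg fun s hs => noCore_summand_nonneg_of_dominating ends x y f g hfm hgm hy s (Finset.mem_filter.mp hs).2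

end Coefficientwise

end Summit.CriticalPhenomena.PercolationContinuityZ3.Theorems
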